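import Summits.AnomalousDissipation.AnomalousDissipation.Theorems.WindLineWindyGalerkinSteadyZerothLawGenericLeafNondegeneracyToolsE
import Literature.Analysis.FluidPDE.SteadyNSLatticePersistence

/-!
# Generic leaf-nondegeneracy (stub B of crux `WindLine.WindyGalerkinSteadyZerothLaw`,
# stmt-AnomalousDissipation-11414), tools F: `c·1 + C` has Fredholm index zero

Helper layer (pure proof file, no definitions; abstract functional analysis on a real Banach space
`E`), sequel of tools E.  For `S` with `S x = c x + C x`, `C` compact, `c ≠ 0`, with kernel `K` and
range `R`:

* `finrank_le_finrank_ker_of_inf_range` — a finite-dimensional subspace meeting `R` trivially has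
  dimension `≤ dim K` (perturb `S` by a finite-rank map `K → C₁` through a projection onto `K`; the
  perturbation is injective, hence surjective by the Fredholm alternative
  `SteadyLattice.exists_equiv_of_injective`, which is absurd if `K → C₁` is not onto);
* `exists_isCompl_range` — hence `R` has a finite-dimensional complement (one of maximal dimension
  among the subspaces meeting `R` trivially);
* `finrank_ker_le_of_isCompl_range` — every finite-dimensional complement of `R` has dimension
  `≥ dim K` (perturb by a surjection `K → C'`; the perturbation is surjective, hence injective by
  `injective_of_surjective` of tools E);
* `exists_isCompl_range_finrank_eq` — **index zero**: `R` is closed and admits a complement of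
  dimension exactly `dim K < ∞`.

References: Kress, *Linear Integral Equations*, Thm. 3.4; Brezis, *Functional Analysis*, Thm. 6.6.
-/

noncomputable section

-- D-0017: single-problem summit ⇒ the duplicated namespace segment is by design.
set_option linter.dupNamespace false

open scoped Topology NNReal
open Filter Set Function

namespace Summit.AnomalousDissipation.AnomalousDissipation.Theorems.WindLineWindyGalerkinSteadyZerothLaw.GenericLeaf

section IndexZero

variable {E : Type*} [NormedAddCommGroup E] [NormedSpace ℝ E] [CompleteSpace E]
variable {C S : E →L[ℝ] E} {c : ℝ}

/-! ## §1 Finite-rank perturbations through a projection onto the kernel -/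

omit [CompleteSpace E] in
/-- **The finite-rank perturbation `S − ι ∘ φ ∘ P`** of `S = c + C` (`P` a projection onto the kernel
`K`, `φ : K → C₁` linear into a finite-dimensional `C₁`) is again of the form `c + compact`. [folklore] -/
theorem exists_perturb (hC : IsCompactOperator C) (hS : ∀ x, S x = c • x + C x)
    [FiniteDimensional ℝ (LinearMap.ker (S : E →ₗ[ℝ] E))]
    (P : E →L[ℝ] LinearMap.ker (S : E →ₗ[ℝ] E)) (C₁ : Submodule ℝ E) [FiniteDimensional ℝ C₁]
    (φ : LinearMap.ker (S : E →ₗ[ℝ] E) →ₗ[ℝ] C₁) :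
    ∃ (S' C' : E →L[ℝ] E), IsCompactOperator C' ∧ (∀ x, S' x = c • x + C' x) ∧
      ∀ x, S' x = S x - (φ (P x) : E) := by
  set Fr : E →L[ℝ] E := C₁.subtypeL.comp ((LinearMap.toContinuousLinearMap φ).comp P) with hFr
  have hFrx : ∀ x, Fr x = (φ (P x) : E) := fun x => rfl
  have hFrc : IsCompactOperator Fr :=
    (isCompactOperator_of_locallyCompactSpace_dom ((LinearMap.toContinuousLinearMap φ).comp P)).clm_comp C₁.subtypeL
  have hsub : ∀ (A A' : E →L[ℝ] E) (x : E), (A - A') x = A x - A' x := fun A A' x => rfl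
  refine ⟨S - Fr, C - Fr, hC.sub hFrc, fun x => ?_, fun x => by rw [hsub, hFrx]⟩
  rw [hsub, hsub, hS]
  abel

omit [CompleteSpace E] in
/-- Kernel of the perturbation when `C₁ ⊓ R = ⊥`: `S' v = 0` iff `S v = 0` and `φ (P v) = 0`. [folklore] -/
theorem perturb_eq_zero_iff [FiniteDimensional ℝ (LinearMap.ker (S : E →ₗ[ℝ] E))]
    (P : E →L[ℝ] LinearMap.ker (S : E →ₗ[ℝ] E)) (C₁ : Submodule ℝ E)
    (hC₁ : C₁ ⊓ LinearMap.range (S : E →ₗ[ℝ] E) = ⊥)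
    (φ : LinearMap.ker (S : E →ₗ[ℝ] E) →ₗ[ℝ] C₁) {S' : E →L[ℝ] E} (hS' : ∀ x, S' x = S x - (φ (P x) : E)) (v : E) :
    S' v = 0 ↔ S v = 0 ∧ φ (P v) = 0 := by
  constructor
  · intro h
    rw [hS', sub_eq_zero] at h
    have hmem : S v ∈ C₁ ⊓ LinearMap.range (S : E →ₗ[ℝ] E) := ⟨by rw [h]; exact (φ (P v)).2, ⟨v, rfl⟩⟩
    rw [hC₁, Submodule.mem_bot] at hmem
    refine ⟨hmem, ?_⟩
    rw [hmem] at h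
    exact Subtype.ext h.symm
  · rintro ⟨h1, h2⟩
    rw [hS', h1, h2, Submodule.coe_zero, sub_zero]

/-! ## §2 Codimension of the range is at most the dimension of the kernel -/

omit [CompleteSpace E] in
/-- `rank < rank` from `finrank < finrank` for finite-dimensional subspaces. [folklore] -/
theorem rank_lt_rank_of_finrank_lt (V V' : Submodule ℝ E) [FiniteDimensional ℝ V] [FiniteDimensional ℝ V']
    (h : Module.finrank ℝ V < Module.finrank ℝ V') : Module.rank ℝ V < Module.rank ℝ V' := by
  rw [← Module.finrank_eq_rank', ← Module.finrank_eq_rank']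
  exact_mod_cast h

/-- **A finite-dimensional subspace meeting the range trivially has dimension `≤ dim ker S`.**
[folklore] -/
theorem finrank_le_finrank_ker_of_inf_range (hC : IsCompactOperator C) (hc : c ≠ 0) (hS : ∀ x, S x = c • x + C x)
    (C₁ : Submodule ℝ E) [FiniteDimensional ℝ C₁] (hC₁ : C₁ ⊓ LinearMap.range (S : E →ₗ[ℝ] E) = ⊥) :
    Module.finrank ℝ C₁ ≤ Module.finrank ℝ (LinearMap.ker (S : E →ₗ[ℝ] E)) := by
  haveI := finiteDimensional_ker hC hc hS
  set K := LinearMap.ker (S : E →ₗ[ℝ] E) with hK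
  by_contra hlt
  rw [not_le] at hlt
  -- an injective, non-surjective `φ : K → C₁`
  obtain ⟨φ, hφ⟩ := Module.Free.exists_linearMap_injective_of_rank_lt (rank_lt_rank_of_finrank_lt K C₁ hlt)
  have hφns : ¬ Function.Surjective φ := fun hsurj =>
    (ne_of_lt hlt) (LinearEquiv.finrank_eq (LinearEquiv.ofBijective φ ⟨hφ, hsurj⟩))
  -- projection onto `K` and the perturbation
  obtain ⟨P, hP⟩ := Submodule.ClosedComplemented.of_finiteDimensional K
  obtain ⟨S', C', hC', hS'c, hS'⟩ := exists_perturb hC hS P C₁ φ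
  -- `S'` is injective
  have hinj : ∀ x, c • x + C' x = 0 → x = 0 := by
    intro x hx
    rw [← hS'c] at hx
    obtain ⟨h1, h2⟩ := (perturb_eq_zero_iff P C₁ hC₁ φ hS' x).1 hx
    have hxK : x ∈ K := h1
    have hPx : P x = ⟨x, hxK⟩ := hP ⟨x, hxK⟩
    rw [hPx] at h2
    have := hφ (h2.trans (map_zero φ).symm)
    exact congrArg Subtype.val this
  -- hence surjective: contradiction with a `y₀ ∈ C₁` off the range of `φ`
  obtain ⟨L, hL⟩ := Literature.Analysis.FluidPDE.SteadyLattice.exists_equiv_of_injective hC' hc hinj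
  obtain ⟨y₀, hy₀⟩ := not_forall.1 hφns
  obtain ⟨v, hv⟩ := L.surjective (y₀ : E)
  rw [hL, ← hS'c, hS'] at hv
  -- `S v = y₀ + φ (P v) ∈ C₁ ∩ R`, so `S v = 0`
  have hSv : S v ∈ C₁ ⊓ LinearMap.range (S : E →ₗ[ℝ] E) := by
    refine ⟨?_, ⟨v, rfl⟩⟩
    have e : S v = (y₀ : E) + (φ (P v) : E) := by rw [← hv]; abel
    rw [e]
    exact C₁.add_mem y₀.2 (φ (P v)).2
  rw [hC₁, Submodule.mem_bot] at hSv
  rw [hSv, zero_sub] at hv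
  exact hy₀ ⟨-(P v), Subtype.ext (by rw [map_neg, Submodule.coe_neg, hv])⟩

/-! ## §3 A finite-dimensional complement of the range -/

/-- **The range of `c·1 + C` has a finite-dimensional complement** of dimension `≤ dim ker S`: a
subspace of maximal dimension among those meeting the range trivially (these dimensions are bounded
by §2) is a complement. [folklore] -/
theorem exists_isCompl_range (hC : IsCompactOperator C) (hc : c ≠ 0) (hS : ∀ x, S x = c • x + C x) :
    ∃ C' : Submodule ℝ E, FiniteDimensional ℝ C' ∧ IsCompl (LinearMap.range (S : E →ₗ[ℝ] E)) C' ∧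
      Module.finrank ℝ C' ≤ Module.finrank ℝ (LinearMap.ker (S : E →ₗ[ℝ] E)) := by
  classical
  set R := LinearMap.range (S : E →ₗ[ℝ] E) with hR
  set n := Module.finrank ℝ (LinearMap.ker (S : E →ₗ[ℝ] E)) with hn
  set Pd : ℕ → Prop := fun d => ∃ C₁ : Submodule ℝ E, FiniteDimensional ℝ C₁ ∧ Module.finrank ℝ C₁ = d ∧ C₁ ⊓ R = ⊥
    with hPd
  have hP0 : Pd 0 := ⟨⊥, inferInstance, finrank_bot ℝ E, bot_inf_eq _⟩
  have hPle : ∀ d, Pd d → d ≤ n := by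
    rintro d ⟨C₁, hfd, rfl, hC₁⟩
    exact finrank_le_finrank_ker_of_inf_range hC hc hS C₁ hC₁
  set d₀ := Nat.findGreatest Pd n with hd₀
  obtain ⟨C₁, hfd, hdim, hC₁⟩ : Pd d₀ := Nat.findGreatest_spec (Nat.zero_le n) hP0
  haveI := hfd
  refine ⟨C₁, hfd, ⟨disjoint_iff.2 (by rw [inf_comm]; exact hC₁), codisjoint_iff.2 ?_⟩, hdim ▸ hPle _ ⟨C₁, hfd, hdim, hC₁⟩⟩
  -- maximality: `R ⊔ C₁ = ⊤`
  by_contra htop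
  obtain ⟨w, hw⟩ : ∃ w : E, w ∉ R ⊔ C₁ := by
    by_contra hall
    push Not at hall
    exact htop (Submodule.eq_top_iff'.2 hall)
  have hw0 : w ≠ 0 := fun h => hw (by rw [h]; exact Submodule.zero_mem _)
  have hwC : w ∉ C₁ := fun h => hw (Submodule.mem_sup_right h)
  set C₂ : Submodule ℝ E := C₁ ⊔ ℝ ∙ w with hC₂
  haveI : FiniteDimensional ℝ (ℝ ∙ w) := inferInstance
  haveI : FiniteDimensional ℝ C₂ := Submodule.finiteDimensional_sup _ _
  have hinf : C₁ ⊓ (ℝ ∙ w) = ⊥ := by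
    rw [Submodule.eq_bot_iff]
    rintro x ⟨hx1, hx2⟩
    obtain ⟨a, rfl⟩ := Submodule.mem_span_singleton.1 hx2
    by_cases ha : a = 0
    · rw [ha, zero_smul]
    · exfalso
      apply hwC
      have : w = a⁻¹ • (a • w) := by rw [smul_smul, inv_mul_cancel₀ ha, one_smul]
      rw [this]
      exact C₁.smul_mem _ hx1
  have hdim2 : Module.finrank ℝ C₂ = d₀ + 1 := by
    have h := Submodule.finrank_sup_add_finrank_inf_eq C₁ (ℝ ∙ w)
    rw [hinf, finrank_bot, add_zero, finrank_span_singleton hw0, hdim] at h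
    exact h
  have hC₂R : C₂ ⊓ R = ⊥ := by
    rw [Submodule.eq_bot_iff]
    rintro x ⟨hx2, hxR⟩
    obtain ⟨c₁, hc₁, y, hy, rfl⟩ := Submodule.mem_sup.1 hx2
    obtain ⟨a, rfl⟩ := Submodule.mem_span_singleton.1 hy
    by_cases ha : a = 0
    · subst ha
      rw [zero_smul, add_zero] at hxR ⊢
      have : c₁ ∈ C₁ ⊓ R := ⟨hc₁, hxR⟩
      rwa [hC₁, Submodule.mem_bot] at this
    · exfalso
      apply hw
      have e : w = a⁻¹ • ((c₁ + a • w) - c₁) := by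
        rw [add_sub_cancel_left, smul_smul, inv_mul_cancel₀ ha, one_smul]
      rw [e]
      exact Submodule.smul_mem _ _ (Submodule.sub_mem _ (Submodule.mem_sup_left hxR) (Submodule.mem_sup_right hc₁))
  have hPd2 : Pd (d₀ + 1) := ⟨C₂, inferInstance, hdim2, hC₂R⟩
  have hle : d₀ + 1 ≤ n := hPle _ hPd2
  exact Nat.findGreatest_is_greatest (Nat.lt_succ_self d₀) hle hPd2

/-! ## §4 Every complement of the range has dimension at least the dimension of the kernel -/

omit [CompleteSpace E] in
/-- **A finite-dimensional complement of the range has dimension `≥ dim ker S`** (perturb `S` by a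
surjection `K → C'` through a projection onto `K`: the perturbation is surjective, hence injective by
`injective_of_surjective`, which is absurd if `K → C'` has a kernel). [folklore] -/
theorem finrank_ker_le_of_isCompl_range (hC : IsCompactOperator C) (hc : c ≠ 0) (hS : ∀ x, S x = c • x + C x)
    (C' : Submodule ℝ E) [FiniteDimensional ℝ C'] (hC' : IsCompl (LinearMap.range (S : E →ₗ[ℝ] E)) C') :
    Module.finrank ℝ (LinearMap.ker (S : E →ₗ[ℝ] E)) ≤ Module.finrank ℝ C' := by
  haveI := finiteDimensional_ker hC hc hS
  set K := LinearMap.ker (S : E →ₗ[ℝ] E) with hK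
  set R := LinearMap.range (S : E →ₗ[ℝ] E) with hR
  by_contra hlt
  rw [not_le] at hlt
  -- an injective `ψ : C' → K` and a left inverse `φ : K → C'` (surjective, with a kernel)
  obtain ⟨ψ, hψ⟩ := Module.Free.exists_linearMap_injective_of_rank_lt (rank_lt_rank_of_finrank_lt C' K hlt)
  obtain ⟨φ, hφψ⟩ := LinearMap.exists_leftInverse_of_injective ψ (LinearMap.ker_eq_bot.2 hψ)
  have hφψx : ∀ x, φ (ψ x) = x := fun x => by
    have := congrArg (fun f => f x) hφψ
    simpa using this
  have hφni : ¬ Function.Injective φ := fun hinj => by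
    have hsurj : Function.Surjective φ := fun x => ⟨ψ x, hφψx x⟩
    exact (ne_of_lt hlt) (LinearEquiv.finrank_eq (LinearEquiv.ofBijective φ ⟨hinj, hsurj⟩)).symm
  -- projection onto `K` and the perturbation
  obtain ⟨P, hP⟩ := Submodule.ClosedComplemented.of_finiteDimensional K
  obtain ⟨S', C'', hC'', hS'c, hS'⟩ := exists_perturb hC hS P C' φ
  -- `S'` is surjective
  have hsurj : Function.Surjective S' := by
    intro y
    have hy : y ∈ R ⊔ C' := by rw [hC'.sup_eq_top]; trivial
    obtain ⟨r, hr, c', hc', rfl⟩ := Submodule.mem_sup.1 hy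
    obtain ⟨v₀, hv₀⟩ := hr
    set v₁ : E := v₀ - (P v₀ : E) with hv₁
    have hSv₁ : S v₁ = r := by
      rw [hv₁, map_sub, show S (P v₀ : E) = 0 from (P v₀).2, sub_zero]
      exact hv₀
    have hPv₁ : P v₁ = 0 := by
      rw [hv₁, map_sub, hP (P v₀), sub_self]
    set k₀ : K := ψ ⟨-c', C'.neg_mem hc'⟩ with hk₀
    refine ⟨v₁ + (k₀ : E), ?_⟩
    rw [hS', map_add, map_add, hSv₁, show S (k₀ : E) = 0 from k₀.2, add_zero, hPv₁, zero_add, hP k₀, hk₀, hφψx]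
    simp
  -- hence injective: contradiction with a kernel vector of `φ`
  have hinj : Function.Injective S' := injective_of_surjective hC'' hc hS'c hsurj
  apply hφni
  intro a b hab
  have h : S' (a : E) = S' (b : E) := by
    rw [hS', hS', show S (a : E) = 0 from a.2, show S (b : E) = 0 from b.2, hP a, hP b, hab]
  exact Subtype.ext (hinj h)

/-! ## §5 Index zero -/

/-- **`c·1 + C` has Fredholm index zero** (`C` compact on a real Banach space, `c ≠ 0`): the kernel
is finite-dimensional, the range is closed, and the range has a complement of dimension exactly the
dimension of the kernel. [folklore] -/
theorem exists_isCompl_range_finrank_eq (hC : IsCompactOperator C) (hc : c ≠ 0) (hS : ∀ x, S x = c • x + C x) :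
    FiniteDimensional ℝ (LinearMap.ker (S : E →ₗ[ℝ] E)) ∧
    IsClosed ((LinearMap.range (S : E →ₗ[ℝ] E) : Submodule ℝ E) : Set E) ∧
    ∃ C' : Submodule ℝ E, FiniteDimensional ℝ C' ∧ IsCompl (LinearMap.range (S : E →ₗ[ℝ] E)) C' ∧
      Module.finrank ℝ C' = Module.finrank ℝ (LinearMap.ker (S : E →ₗ[ℝ] E)) := by
  obtain ⟨C', hfd, hcompl, hle⟩ := exists_isCompl_range hC hc hS
  haveI := hfd
  exact ⟨finiteDimensional_ker hC hc hS, isClosed_range_of_compact hC hc hS, C', hfd, hcompl,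
    le_antisymm hle (finrank_ker_le_of_isCompl_range hC hc hS C' hcompl)⟩

end IndexZero

/-! ## §6 Registered sub-goal -/

/-- **Registered sub-goal `genericLeaf_toolsF`** (worker B of stub `stub_genericLeafNondegeneracy`):
Fredholm index zero for `c·1 + compact` on a real Banach space, `exists_isCompl_range_finrank_eq` in
Pi-form. [folklore] -/
theorem genericLeaf_toolsF : ∀ {E : Type*} [NormedAddCommGroup E] [NormedSpace ℝ E] [CompleteSpace E] {C S : E →L[ℝ] E} {c : ℝ}, IsCompactOperator C → c ≠ 0 → (∀ x, S x = c • x + C x) → FiniteDimensional ℝ (LinearMap.ker (S : E →ₗ[ℝ] E)) ∧ IsClosed ((LinearMap.range (S : E →ₗ[ℝ] E) : Submodule ℝ E) : Set E) ∧ ∃ C' : Submodule ℝ E, FiniteDimensional ℝ C' ∧ IsCompl (LinearMap.range (S : E →ₗ[ℝ] E)) C' ∧ Module.finrank ℝ C' = Module.finrank ℝ (LinearMap.ker (S : E →ₗ[ℝ] E)) :=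
  fun hC hc hS => exists_isCompl_range_finrank_eq hC hc hS

end Summit.AnomalousDissipation.AnomalousDissipation.Theorems.WindLineWindyGalerkinSteadyZerothLaw.GenericLeaf

end
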